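import Mathlib.Topology.Sequences
import Mathlib.Analysis.SpecificLimits.Basic
import Mathlib.Analysis.Normed.Group.Continuity
import Mathlib.Algebra.Order.Field.GeomSum
import HarnessLib

/-!
# NE7DefectIterationCompact — THE EXISTENCE ENGINE OF THE NONLINEAR SLICE THEOREM (S1): a step map that CONTRACTS a continuous «defect» by a factor `θ < 1` and moves a
# continuous «size» by at most `A·defect`, iterated from a datum with size `≤ s₀` and defect `≤ δ₀` inside a COMPACT set, has an EXACT zero of the defect in that set with
# size `≤ s₀ + A·δ₀/(1 − θ)` — iterate, geometric bookkeeping, a convergent subsequence (compactness), continuity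

Cell `pub-balaban`, rung (B)+1 sub-cell t4, lineage `b2b-balaban-t4-ne7-p1`, generation 100 (CRUX PROVER NE7 #1 = OWNER of BINDER row NE7).  Memo
`t4/b2b-balaban-t4-ne7-p1-g100/ROAD-G100.md` §2 (the supplier (S1) of the Bałaban-slice road, `t4/…-g99/ROAD-G99.md` §3.8 (B) ∕ §3.9, made definite): the EXACT `𝒯_E`-slice
representative of an admissible pair is obtained by ITERATED LINEAR REGAUGING `u ↦ e^{−ζ(u)}·u` (ζ(u) = the gauge function of the linear slice decomposition of the current
representative `X(u) = log(U♯⁻¹·U′^{u})`, `NE7EnergySliceFullGaugeSplit`), whose DEFECT (the sup of the gauge component `D_{U♯}ζ(u)`) contracts by `θ ≍ (K + 10³⁴)·ε` per step in SUP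
NORM ALONE — because the curl of every regauged representative is the pair's relative plaquette field (`≤ 2ε∕M²` for EVERY unitary gauge, `‖Ad_u F‖ = ‖F‖`), so no gradient of the BCH
junk is ever needed — while the size `sup‖X(u)‖` moves by at most `(1 + θ₁)·defect`.  Existence of the EXACT representative then needs NO Cauchy estimate, NO implicit-function theorem and
NO continuity method: the periodic unitary gauge group is COMPACT, the iterates have a convergent subsequence, the defect (continuous) of the limit is `lim θ^j δ₀ = 0`, and the size bound
passes to the limit.  THIS FILE is that engine in the abstract (pure topology ∕ real bookkeeping; [folklore]; 0 def, 0 sorry):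
§1 **`iterate_invariant`**: along `step^[j] u₀` — membership in `K`, `defect ≤ θ^j·δ₀`, `size ≤ s₀ + A·δ₀·Σ_{i<j} θ^i ≤ s₀ + A·δ₀∕(1−θ) ≤ S`
   (the hypotheses on `step` are asked only on `K ∩ {size ≤ S}`);
§2 **`exists_zero_defect`**: `K` compact (first-countable ambient space), `Φ` (size, values in a seminormed group) and `Df ≥ 0` (defect) continuous on `K` ⟹
   `∃ u ∈ K, Df u = 0 ∧ ‖Φ u‖ ≤ s₀ + A·δ₀∕(1 − θ)`; **`exists_zero_defect_of_mapsTo`** (the variant with `step` mapping `K` into `K` outright).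
HOW IT IS CONSUMED (successor; memo §2): `α` = periodic unit-valued site fields (or their restriction to the period box), `K` = the unitary ones (compact: `U(n)^{box}`), `Φ u = X(u)`
restricted to the period box (sup norm), `Df u = sup‖D_{U♯}ζ(X(u))‖` (a continuous function of `X(u)`, linear algebra of `NE7EnergySliceFullGaugeSplit` ∕ `NE7MeanZeroGaugeSliceW`), `step` =
one regauging; (h-contr)∕(h-grow) = the one-step letters of memo §2.3 (BCH remainders of the tree + THE curved sup letter of `𝒯_E`); the zero-defect limit IS the exact slice representative
fed to `NE7DecompOfDirectLettersSlice.decomp_of_directLetters_coarse`.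
HONEST FRAMING (page 1): an abstract existence lemma; discharges nothing of NE7 by itself; the one-step letters and the curved sup letter are NOT here; NE7 NOT PROVED; spine 0∕9; finite T⁴
rung (B)+1 — NOT infinite volume, NOT mass gap, NOT BetaPertH, NOT Clay.  Continuum YM on T⁴ ⇐ BetaPertH ∧ nine spine estimates (0/9 proved); BetaPertH ⇐ (D1) ∧ (D4) ∧ CAP+tail;
G-an2-4 gates asym, D1 and NE2/3/4.
-/

set_option autoImplicit false

open Filter Topology Finset

namespace Summit.QuantumFields.BalabanUV.T4Continuum.NE7DefectIterationCompact

/-! ## §1 Geometric bookkeeping along the iteration (`Σ_{i<j} θ^i ≤ 1∕(1−θ)` is Mathlib's `geom_sum_Ico_le_of_lt_one` at `m = 0`; also `Literature.Dynamics.Hyperbolic.sum_pow_le_one_div`) -/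

section Engine

variable {α : Type*} {E : Type*} [SeminormedAddCommGroup E]
variable {K : Set α} {step : α → α} {Φ : α → E} {Df : α → ℝ} {θ A S s₀ δ₀ : ℝ} {u₀ : α}

/-- **THE INVARIANT OF THE ITERATION**: if on `K ∩ {‖Φ‖ ≤ S}` the step stays in `K`, contracts the defect (`Df (step u) ≤ θ·Df u`) and moves the size by at most `A·Df u`,
and `s₀ + A·δ₀∕(1−θ) ≤ S`, then the `j`-th iterate of a datum `u₀ ∈ K` with `‖Φ u₀‖ ≤ s₀`, `Df u₀ ≤ δ₀` lies in `K`, has defect `≤ θ^j·δ₀` and size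
`≤ s₀ + A·δ₀·Σ_{i<j} θ^i`. [folklore] -/
theorem iterate_invariant (hθ0 : 0 ≤ θ) (hθ1 : θ < 1) (hA : 0 ≤ A) (hδ₀ : 0 ≤ δ₀) (hS : s₀ + A * δ₀ / (1 - θ) ≤ S)
    (hmaps : ∀ u ∈ K, ‖Φ u‖ ≤ S → step u ∈ K)
    (hcontr : ∀ u ∈ K, ‖Φ u‖ ≤ S → Df (step u) ≤ θ * Df u)
    (hgrow : ∀ u ∈ K, ‖Φ u‖ ≤ S → ‖Φ (step u)‖ ≤ ‖Φ u‖ + A * Df u)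
    (hu₀ : u₀ ∈ K) (hs₀ : ‖Φ u₀‖ ≤ s₀) (hd₀ : Df u₀ ≤ δ₀) (j : ℕ) :
    step^[j] u₀ ∈ K ∧ Df (step^[j] u₀) ≤ θ ^ j * δ₀ ∧ ‖Φ (step^[j] u₀)‖ ≤ s₀ + A * δ₀ * ∑ i ∈ range j, θ ^ i := by
  induction j with
  | zero =>
    refine ⟨?_, ?_, ?_⟩
    · simpa using hu₀
    · simpa using hd₀
    · simpa using hs₀
  | succ j ih =>
    obtain ⟨hK, hD, hN⟩ := ih
    have hsum : A * δ₀ * ∑ i ∈ range j, θ ^ i ≤ A * δ₀ / (1 - θ) := by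
      have hg : ∑ i ∈ range j, θ ^ i ≤ 1 / (1 - θ) := by
        have h := geom_sum_Ico_le_of_lt_one (m := 0) (n := j) hθ0 hθ1
        rwa [pow_zero, ← range_eq_Ico] at h
      have h := mul_le_mul_of_nonneg_left hg (mul_nonneg hA hδ₀)
      calc A * δ₀ * ∑ i ∈ range j, θ ^ i ≤ A * δ₀ * (1 / (1 - θ)) := h
        _ = A * δ₀ / (1 - θ) := by ring
    have hNS : ‖Φ (step^[j] u₀)‖ ≤ S := by linarith
    rw [Function.iterate_succ_apply']
    refine ⟨hmaps _ hK hNS, ?_, ?_⟩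
    · calc Df (step (step^[j] u₀)) ≤ θ * Df (step^[j] u₀) := hcontr _ hK hNS
        _ ≤ θ * (θ ^ j * δ₀) := mul_le_mul_of_nonneg_left hD hθ0
        _ = θ ^ (j + 1) * δ₀ := by ring
    · calc ‖Φ (step (step^[j] u₀))‖ ≤ ‖Φ (step^[j] u₀)‖ + A * Df (step^[j] u₀) := hgrow _ hK hNS
        _ ≤ (s₀ + A * δ₀ * ∑ i ∈ range j, θ ^ i) + A * (θ ^ j * δ₀) := add_le_add hN (mul_le_mul_of_nonneg_left hD hA)
        _ = s₀ + A * δ₀ * ∑ i ∈ range (j + 1), θ ^ i := by rw [Finset.sum_range_succ]; ring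

/-- the size bound of the invariant in closed form: `‖Φ (step^[j] u₀)‖ ≤ s₀ + A·δ₀∕(1 − θ)`. [folklore] -/
theorem iterate_norm_le (hθ0 : 0 ≤ θ) (hθ1 : θ < 1) (hA : 0 ≤ A) (hδ₀ : 0 ≤ δ₀) (hS : s₀ + A * δ₀ / (1 - θ) ≤ S)
    (hmaps : ∀ u ∈ K, ‖Φ u‖ ≤ S → step u ∈ K)
    (hcontr : ∀ u ∈ K, ‖Φ u‖ ≤ S → Df (step u) ≤ θ * Df u)
    (hgrow : ∀ u ∈ K, ‖Φ u‖ ≤ S → ‖Φ (step u)‖ ≤ ‖Φ u‖ + A * Df u)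
    (hu₀ : u₀ ∈ K) (hs₀ : ‖Φ u₀‖ ≤ s₀) (hd₀ : Df u₀ ≤ δ₀) (j : ℕ) :
    ‖Φ (step^[j] u₀)‖ ≤ s₀ + A * δ₀ / (1 - θ) := by
  have h := (iterate_invariant hθ0 hθ1 hA hδ₀ hS hmaps hcontr hgrow hu₀ hs₀ hd₀ j).2.2
  have hsum : A * δ₀ * ∑ i ∈ range j, θ ^ i ≤ A * δ₀ / (1 - θ) := by
    have hg : ∑ i ∈ range j, θ ^ i ≤ 1 / (1 - θ) := by
      have h := geom_sum_Ico_le_of_lt_one (m := 0) (n := j) hθ0 hθ1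
      rwa [pow_zero, ← range_eq_Ico] at h
    have h' := mul_le_mul_of_nonneg_left hg (mul_nonneg hA hδ₀)
    calc A * δ₀ * ∑ i ∈ range j, θ ^ i ≤ A * δ₀ * (1 / (1 - θ)) := h'
      _ = A * δ₀ / (1 - θ) := by ring
  linarith

/-! ## §2 Compactness: an exact zero of the defect -/

variable [TopologicalSpace α] [FirstCountableTopology α]

/-- **THE ENGINE — AN EXACT ZERO OF THE DEFECT WITH THE SIZE BOUND.**  `K` compact (in a first-countable space), `Φ` and `Df` continuous on `K`, `Df ≥ 0` on `K`; on
`K ∩ {‖Φ‖ ≤ S}` the step stays in `K`, contracts `Df` by `θ ∈ [0,1)` and moves `‖Φ‖` by at most `A·Df`; `u₀ ∈ K` with `‖Φ u₀‖ ≤ s₀`, `Df u₀ ≤ δ₀`, and `s₀ + A·δ₀∕(1−θ) ≤ S`.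
THEN `∃ u ∈ K, Df u = 0 ∧ ‖Φ u‖ ≤ s₀ + A·δ₀∕(1 − θ)`.  [Iterate (§1); a subsequence converges in `K`; `Df` of the limit is the limit of `Df ≤ θ^j δ₀ → 0`; the size bound is
closed.] [folklore] -/
theorem exists_zero_defect (hK : IsCompact K) (hΦ : ContinuousOn Φ K) (hDf : ContinuousOn Df K) (hDf0 : ∀ u ∈ K, 0 ≤ Df u)
    (hθ0 : 0 ≤ θ) (hθ1 : θ < 1) (hA : 0 ≤ A) (hδ₀ : 0 ≤ δ₀) (hS : s₀ + A * δ₀ / (1 - θ) ≤ S)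
    (hmaps : ∀ u ∈ K, ‖Φ u‖ ≤ S → step u ∈ K)
    (hcontr : ∀ u ∈ K, ‖Φ u‖ ≤ S → Df (step u) ≤ θ * Df u)
    (hgrow : ∀ u ∈ K, ‖Φ u‖ ≤ S → ‖Φ (step u)‖ ≤ ‖Φ u‖ + A * Df u)
    (hu₀ : u₀ ∈ K) (hs₀ : ‖Φ u₀‖ ≤ s₀) (hd₀ : Df u₀ ≤ δ₀) :
    ∃ u ∈ K, Df u = 0 ∧ ‖Φ u‖ ≤ s₀ + A * δ₀ / (1 - θ) := by
  set x : ℕ → α := fun j => step^[j] u₀ with hx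
  have hinv := fun j => iterate_invariant hθ0 hθ1 hA hδ₀ hS hmaps hcontr hgrow hu₀ hs₀ hd₀ j
  have hxK : ∀ j, x j ∈ K := fun j => (hinv j).1
  -- a convergent subsequence in the compact set
  obtain ⟨a, haK, φ, hφ, hlim⟩ := hK.tendsto_subseq hxK
  have hlimW : Tendsto (x ∘ φ) atTop (𝓝[K] a) :=
    tendsto_nhdsWithin_of_tendsto_nhds_of_eventually_within _ hlim (Eventually.of_forall fun m => hxK (φ m))
  -- the defect of the limit vanishes
  have hDlim : Tendsto (fun m => Df ((x ∘ φ) m)) atTop (𝓝 (Df a)) := (hDf a haK).tendsto.comp hlimW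
  have hpow : Tendsto (fun m => θ ^ (φ m) * δ₀) atTop (𝓝 0) := by
    have h := ((tendsto_pow_atTop_nhds_zero_of_lt_one hθ0 hθ1).comp hφ.tendsto_atTop).mul_const δ₀
    rwa [zero_mul] at h
  have hD0 : Tendsto (fun m => Df ((x ∘ φ) m)) atTop (𝓝 0) :=
    squeeze_zero (fun m => hDf0 _ (hxK (φ m))) (fun m => (hinv (φ m)).2.1) hpow
  have hDa : Df a = 0 := tendsto_nhds_unique hDlim hD0
  refine ⟨a, haK, hDa, ?_⟩
  -- the size bound is closed
  have hΦlim : Tendsto (fun m => ‖Φ ((x ∘ φ) m)‖) atTop (𝓝 ‖Φ a‖) :=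
    Filter.Tendsto.norm ((hΦ a haK).tendsto.comp hlimW)
  exact le_of_tendsto' hΦlim fun m => iterate_norm_le hθ0 hθ1 hA hδ₀ hS hmaps hcontr hgrow hu₀ hs₀ hd₀ (φ m)

/-- **THE ENGINE, `step` MAPPING `K` INTO `K` OUTRIGHT** (the form used when `K` is the whole periodic unitary gauge group). [folklore] -/
theorem exists_zero_defect_of_mapsTo (hK : IsCompact K) (hΦ : ContinuousOn Φ K) (hDf : ContinuousOn Df K) (hDf0 : ∀ u ∈ K, 0 ≤ Df u)
    (hθ0 : 0 ≤ θ) (hθ1 : θ < 1) (hA : 0 ≤ A) (hδ₀ : 0 ≤ δ₀) (hS : s₀ + A * δ₀ / (1 - θ) ≤ S)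
    (hmaps : Set.MapsTo step K K)
    (hcontr : ∀ u ∈ K, ‖Φ u‖ ≤ S → Df (step u) ≤ θ * Df u)
    (hgrow : ∀ u ∈ K, ‖Φ u‖ ≤ S → ‖Φ (step u)‖ ≤ ‖Φ u‖ + A * Df u)
    (hu₀ : u₀ ∈ K) (hs₀ : ‖Φ u₀‖ ≤ s₀) (hd₀ : Df u₀ ≤ δ₀) :
    ∃ u ∈ K, Df u = 0 ∧ ‖Φ u‖ ≤ s₀ + A * δ₀ / (1 - θ) :=
  exists_zero_defect hK hΦ hDf hDf0 hθ0 hθ1 hA hδ₀ hS (fun _ hu _ => hmaps hu) hcontr hgrow hu₀ hs₀ hd₀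

/-- **THE SIZE-ONLY READING** (no `S` bookkeeping for the consumer): if the step letters hold on `K ∩ {‖Φ‖ ≤ 2s₀}` and `A·δ₀ ≤ (1 − θ)·s₀` (`0 ≤ s₀`), the exact zero has
`‖Φ u‖ ≤ 2·s₀`. [folklore] -/
theorem exists_zero_defect_two (hK : IsCompact K) (hΦ : ContinuousOn Φ K) (hDf : ContinuousOn Df K) (hDf0 : ∀ u ∈ K, 0 ≤ Df u)
    (hθ0 : 0 ≤ θ) (hθ1 : θ < 1) (hA : 0 ≤ A) (hδ₀ : 0 ≤ δ₀) (hsmall : A * δ₀ ≤ (1 - θ) * s₀)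
    (hmaps : ∀ u ∈ K, ‖Φ u‖ ≤ 2 * s₀ → step u ∈ K)
    (hcontr : ∀ u ∈ K, ‖Φ u‖ ≤ 2 * s₀ → Df (step u) ≤ θ * Df u)
    (hgrow : ∀ u ∈ K, ‖Φ u‖ ≤ 2 * s₀ → ‖Φ (step u)‖ ≤ ‖Φ u‖ + A * Df u)
    (hu₀ : u₀ ∈ K) (hs₀ : ‖Φ u₀‖ ≤ s₀) (hd₀ : Df u₀ ≤ δ₀) :
    ∃ u ∈ K, Df u = 0 ∧ ‖Φ u‖ ≤ 2 * s₀ := by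
  have h1 : 0 < 1 - θ := by linarith
  have hS : s₀ + A * δ₀ / (1 - θ) ≤ 2 * s₀ := by
    have : A * δ₀ / (1 - θ) ≤ s₀ := by rw [div_le_iff₀ h1]; linarith
    linarith
  obtain ⟨u, huK, hD, hN⟩ := exists_zero_defect hK hΦ hDf hDf0 hθ0 hθ1 hA hδ₀ hS hmaps hcontr hgrow hu₀ hs₀ hd₀
  exact ⟨u, huK, hD, hN.trans hS⟩

end Engine

end Summit.QuantumFields.BalabanUV.T4Continuum.NE7DefectIterationCompact

namespace Summit.QuantumFields.BalabanUV.T4Continuum.NE7DefectIterationCompact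

open Filter Topology Finset

/-! ## §3 (gen 100 append) The engine with compactness and continuity asked only on the WORKING REGION `{u ∈ K | ‖Φ u‖ ≤ S}` — the representative's
logarithm and the slice defect are continuous only near the identity, and the iterates never leave the working region -/

section EngineLocal

variable {α : Type*} {E : Type*} [SeminormedAddCommGroup E]
variable {K : Set α} {step : α → α} {Φ : α → E} {Df : α → ℝ} {θ A S s₀ δ₀ : ℝ} {u₀ : α}
variable [TopologicalSpace α] [FirstCountableTopology α]

/-- **THE ENGINE, LOCAL FORM**: as `exists_zero_defect`, but compactness, continuity of `Φ` and `Df`, and `Df ≥ 0` are asked only on the working region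
`{u | u ∈ K ∧ ‖Φ u‖ ≤ S}`; the step letters as before on `K ∩ {‖Φ‖ ≤ S}`.  [The iterates lie in the working region by `iterate_invariant`∕`iterate_norm_le`; a subsequence converges
there; continuity there.] [folklore] -/
theorem exists_zero_defect_local (hKS : IsCompact {u | u ∈ K ∧ ‖Φ u‖ ≤ S}) (hΦ : ContinuousOn Φ {u | u ∈ K ∧ ‖Φ u‖ ≤ S})
    (hDf : ContinuousOn Df {u | u ∈ K ∧ ‖Φ u‖ ≤ S}) (hDf0 : ∀ u ∈ K, ‖Φ u‖ ≤ S → 0 ≤ Df u)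
    (hθ0 : 0 ≤ θ) (hθ1 : θ < 1) (hA : 0 ≤ A) (hδ₀ : 0 ≤ δ₀) (hS : s₀ + A * δ₀ / (1 - θ) ≤ S)
    (hmaps : ∀ u ∈ K, ‖Φ u‖ ≤ S → step u ∈ K)
    (hcontr : ∀ u ∈ K, ‖Φ u‖ ≤ S → Df (step u) ≤ θ * Df u)
    (hgrow : ∀ u ∈ K, ‖Φ u‖ ≤ S → ‖Φ (step u)‖ ≤ ‖Φ u‖ + A * Df u)
    (hu₀ : u₀ ∈ K) (hs₀ : ‖Φ u₀‖ ≤ s₀) (hd₀ : Df u₀ ≤ δ₀) :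
    ∃ u ∈ K, Df u = 0 ∧ ‖Φ u‖ ≤ s₀ + A * δ₀ / (1 - θ) := by
  set K' : Set α := {u | u ∈ K ∧ ‖Φ u‖ ≤ S} with hK'
  set x : ℕ → α := fun j => step^[j] u₀ with hx
  have hinv := fun j => iterate_invariant hθ0 hθ1 hA hδ₀ hS hmaps hcontr hgrow hu₀ hs₀ hd₀ j
  have hnorm := fun j => iterate_norm_le hθ0 hθ1 hA hδ₀ hS hmaps hcontr hgrow hu₀ hs₀ hd₀ j
  have hxK' : ∀ j, x j ∈ K' := fun j => ⟨(hinv j).1, (hnorm j).trans hS⟩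
  -- a convergent subsequence in the (compact) working region
  obtain ⟨a, haK', φ, hφ, hlim⟩ := hKS.tendsto_subseq hxK'
  have hlimW : Tendsto (x ∘ φ) atTop (𝓝[K'] a) :=
    tendsto_nhdsWithin_of_tendsto_nhds_of_eventually_within _ hlim (Eventually.of_forall fun m => hxK' (φ m))
  -- the defect of the limit vanishes
  have hDlim : Tendsto (fun m => Df ((x ∘ φ) m)) atTop (𝓝 (Df a)) := (hDf a haK').tendsto.comp hlimW
  have hpow : Tendsto (fun m => θ ^ (φ m) * δ₀) atTop (𝓝 0) := by
    have h := ((tendsto_pow_atTop_nhds_zero_of_lt_one hθ0 hθ1).comp hφ.tendsto_atTop).mul_const δ₀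
    rwa [zero_mul] at h
  have hD0 : Tendsto (fun m => Df ((x ∘ φ) m)) atTop (𝓝 0) :=
    squeeze_zero (fun m => hDf0 _ (hxK' (φ m)).1 (hxK' (φ m)).2) (fun m => (hinv (φ m)).2.1) hpow
  have hDa : Df a = 0 := tendsto_nhds_unique hDlim hD0
  refine ⟨a, haK'.1, hDa, ?_⟩
  have hΦlim : Tendsto (fun m => ‖Φ ((x ∘ φ) m)‖) atTop (𝓝 ‖Φ a‖) :=
    Filter.Tendsto.norm ((hΦ a haK').tendsto.comp hlimW)
  exact le_of_tendsto' hΦlim fun m => hnorm (φ m)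

omit [FirstCountableTopology α] in
/-- **THE WORKING REGION IS COMPACT** when `K` is compact in a Hausdorff space and `Φ` is continuous on `K`. [folklore] -/
theorem isCompact_workingRegion [T2Space α] (hK : IsCompact K) (hΦ : ContinuousOn Φ K) :
    IsCompact {u | u ∈ K ∧ ‖Φ u‖ ≤ S} := by
  have hc : IsClosed (K ∩ Φ ⁻¹' {e : E | ‖e‖ ≤ S}) :=
    hΦ.preimage_isClosed_of_isClosed hK.isClosed (isClosed_le continuous_norm continuous_const)
  have he : {u | u ∈ K ∧ ‖Φ u‖ ≤ S} = K ∩ Φ ⁻¹' {e : E | ‖e‖ ≤ S} := by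
    ext u; simp only [Set.mem_setOf_eq, Set.mem_inter_iff, Set.mem_preimage]
  rw [he]
  exact hK.of_isClosed_subset hc Set.inter_subset_left

/-- **THE ENGINE, LOCAL FORM, COMPACT `K`**: `K` compact (Hausdorff, first-countable ambient space), `Φ` continuous on `K`, `Df` continuous and `≥ 0` on the working region.
[folklore] -/
theorem exists_zero_defect_local_of_compact [T2Space α] (hK : IsCompact K) (hΦ : ContinuousOn Φ K)
    (hDf : ContinuousOn Df {u | u ∈ K ∧ ‖Φ u‖ ≤ S}) (hDf0 : ∀ u ∈ K, ‖Φ u‖ ≤ S → 0 ≤ Df u)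
    (hθ0 : 0 ≤ θ) (hθ1 : θ < 1) (hA : 0 ≤ A) (hδ₀ : 0 ≤ δ₀) (hS : s₀ + A * δ₀ / (1 - θ) ≤ S)
    (hmaps : ∀ u ∈ K, ‖Φ u‖ ≤ S → step u ∈ K)
    (hcontr : ∀ u ∈ K, ‖Φ u‖ ≤ S → Df (step u) ≤ θ * Df u)
    (hgrow : ∀ u ∈ K, ‖Φ u‖ ≤ S → ‖Φ (step u)‖ ≤ ‖Φ u‖ + A * Df u)
    (hu₀ : u₀ ∈ K) (hs₀ : ‖Φ u₀‖ ≤ s₀) (hd₀ : Df u₀ ≤ δ₀) :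
    ∃ u ∈ K, Df u = 0 ∧ ‖Φ u‖ ≤ s₀ + A * δ₀ / (1 - θ) :=
  exists_zero_defect_local (isCompact_workingRegion hK hΦ) (hΦ.mono fun _ hu => hu.1) hDf hDf0 hθ0 hθ1 hA hδ₀ hS
    hmaps hcontr hgrow hu₀ hs₀ hd₀

end EngineLocal

end Summit.QuantumFields.BalabanUV.T4Continuum.NE7DefectIterationCompact
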